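import Literature.NumberTheory.EllipticCurves.HeightDensityFullBSDOffSs3RankZero
import Literature.NumberTheory.EllipticCurves.LeadingTermBSZRankZeroProofs
import HarnessLib

/-!
# Row (ii-3a) of `PERCENT-FULL.md` with its rank-`0` input discharged to Bhargava–Skinner–Zhang's pieces

`HeightDensityFullBSDOffSsRankZero.lean` (and its `p ≥ 3` form `HeightDensityFullBSDOffSs3RankZero.lean`)
types the `pub-bsdpct` cell's row (ii-3a): for at least a proportion `c` of the curves `E_{A,B}/ℚ`,
ordered by naive height, analytic rank `0`, the rank part of BSD, and the full BSD formula `BSD(E,p)` at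
every prime `p ≥ 3` (resp. `p ≥ 5`) of good ordinary or multiplicative reduction — a conditional
transfer on Duke 1997 Thm. 1, Skinner 2016 Thm. C, modularity, Gross–Zagier–Kolyvagin, and the
rank-`0` INPUT `hA0 : HeightDensityGE AnalyticRankZero c`, which there is a bare hypothesis (for
`c⁰ = 17190625/104166656 = 0.16503…`, the conclusion of

> M. Bhargava, C. Skinner, W. Zhang, arXiv:1407.1826 (2014), Cor. 22: "When ordered by height, at
> least `16.50%` of elliptic curves over `ℚ` have both algebraic and analytic rank `0`",

evaluated with Lemma 17's exact `μ(S₀(5))`).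

`LeadingTermBSZRankZeroProofs.lean` proves Cor. 22 from its pieces (`heightDensityGE_rankZero_of_pieces`,
`bsz_cor22_exact_of_pieces`): the finite-height count of Thm. 21 (kernel theorem `thm21_count_five`),
Thm. 5 (the rank-`0` converse, on `S₀(5) ∩ W`), Thm. 13 (the `5`-Selmer average on the twist-stable
union `U` of large families), Thm. 15 (Dokchitser–Dokchitser), Thm. 16 (`κ = .5501`), Lemma 17
(`μ(S₀(5)) = 4·5¹⁰/(5(5¹⁰-1))`) and Lemma 20 (`W` has density one) — each an explicit hypothesis in the
shape used by the tree's Cor. 26 assembly `heightDensityGE_satisfiesBSDRankLeOne_of_pieces`.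

This file composes the two: row (ii-3a) — at `p ≥ 3` and, by nesting, at `p ≥ 5` — for every
`δ ≤ 3/8 · κ · μ₀` and at `c⁰`, with `hA0` REPLACED by Bhargava–Skinner–Zhang's primary inputs. Nothing
is cited beyond the two files' sources; no definition and no named fact is introduced; no constant
changes (`3/8 · (5501/10000) · 4·5¹⁰/(5(5¹⁰-1)) = 17190625/104166656` exactly).

## References

* M. Bhargava, C. Skinner, W. Zhang, arXiv:1407.1826v2 (2014), Thms 5, 13, 15, 16, 21, Lemmas 17, 20,
  Cor. 22 (pp. 8, 10). [cite: BhargavaSkinnerZhang2014, Cor. 22]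
* C. Skinner, Pacific J. Math. 283 (2016) 171–200, Thm. C (p. 173). [cite: Skinner2016PacificMC, Thm. C]
* W. Duke, C. R. Acad. Sci. Paris 325 (1997) 813–818, Thm. 1. [cite: Duke1997, Thm. 1 (p. 815)]
* R. L. Miller, LMS J. Comput. Math. 14 (2011), Def. 1.1 (`BSDp`). [cite: Miller2011LMS, Def. 1.1]
-/

noncomputable section

open scoped Classical
open scoped AddSubgroup
open WeierstrassCurve Filter Topology Literature.NumberTheory.EllipticCurves

namespace Literature.NumberTheory.EllipticCurves

/-- **The rank-`0` input `hA0` of row (ii-3a), from Bhargava–Skinner–Zhang's pieces.** In the notation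
of `heightDensityGE_rankZero_of_pieces` (`S₀ ⊇ U` twist-stable with reversed root numbers, `W` the
`100%` set of Lemma 20, Thm 5 as `h5`, Thm 13 as `h13U`, densities `μ₀`, `κ`): at least a proportion
`δ` of the curves `E_{A,B}`, `δ ≤ 3/8 · κ · μ₀`, are in the height family with `ord_{s=1} L(E_{A,B},s) = 0`
(`AnalyticRankZero`; the algebraic rank, also `0`, is forgotten).
[cite: BhargavaSkinnerZhang2014, Cor. 22 (proof)] -/
theorem heightDensityGE_analyticRankZero_of_pieces
    (hDD : even_selmerRank_sub_torsionRank_iff) (S₀ U W : ℤ × ℤ → Prop)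
    (hUS₀ : ∀ AB, U AB → S₀ AB) (hU : ∀ AB, U AB → U (negB AB))
    (hUflip : ∀ AB, U AB →
      (shortWeierstrass (negB AB)).rootNumber = -(shortWeierstrass AB).rootNumber)
    (h5 : ∀ AB, IsInHeightFamily AB → S₀ AB → W AB →
      Nat.card ((shortWeierstrass AB).selmerGroup 5) = 1 →
        (shortWeierstrass AB).mordellWeilRank = 0 ∧ (shortWeierstrass AB).analyticRank = 0)
    (hWtors : ∀ AB, IsInHeightFamily AB → W AB → (shortWeierstrass AB).toAffine.Point[(5 : ℤ)] = ⊥)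
    (h13U : ∀ η : ℝ, 0 < η → ∀ᶠ X : ℕ in atTop,
      ∑ AB ∈ (heightFamilyBelow X).filter U,
          (Nat.card ((shortWeierstrass AB).selmerGroup 5) : ℝ) ≤
        (6 + η) * ((heightFamilyBelow X).filter U).card)
    {κ μ₀ : ℝ} (hκ : 0 < κ) (hκ1 : κ ≤ 1) (hμ0 : 0 ≤ μ₀) (hμ1 : μ₀ ≤ 1)
    (hS₀ : ∀ η : ℝ, 0 < η → ∀ᶠ X : ℕ in atTop,
      (μ₀ - η) * (heightFamilyBelow X).card ≤ ((heightFamilyBelow X).filter S₀).card)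
    (hκU : ∀ η : ℝ, 0 < η → ∀ᶠ X : ℕ in atTop,
      (κ - η) * ((heightFamilyBelow X).filter S₀).card ≤ ((heightFamilyBelow X).filter U).card)
    (hW : ∀ η : ℝ, 0 < η → ∀ᶠ X : ℕ in atTop,
      (((heightFamilyBelow X).filter (fun AB ↦ ¬ W AB)).card : ℝ) ≤ η * (heightFamilyBelow X).card)
    {δ : ℝ} (hδ : δ ≤ 3 / 8 * κ * μ₀) :
    HeightDensityGE AnalyticRankZero δ :=
  BhargavaSkinnerZhang2014.HeightDensityGE.mono (fun _ h ↦ ⟨h.1, h.2.2⟩)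
    (heightDensityGE_rankZero_of_pieces hDD S₀ U W hUS₀ hU hUflip h5 hWtors h13U hκ hκ1 hμ0 hμ1
      hS₀ hκU hW hδ)

/-- **Row (ii-3a) at `p ≥ 3`, from Bhargava–Skinner–Zhang's pieces (parametrised).** Under the pieces
of Cor. 22 (as in `heightDensityGE_analyticRankZero_of_pieces`) and given Duke 1997 Thm. 1, Skinner 2016
Thm. C, modularity and Gross–Zagier–Kolyvagin: for every `δ ≤ 3/8 · κ · μ₀`, at least a proportion `δ`
of the curves `E_{A,B}/ℚ`, ordered by naive height, have analytic rank `0`, satisfy the rank part of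
BSD, and satisfy `BSD(E,p)` at every prime `p ≥ 3` of good ordinary or multiplicative reduction
(`FullBSDOffSs3Prime`). `= HeightDensityGE.analyticRankZero_and_fullBSDOffSs3Prime_of_sieve` with its
binder `hA0` supplied by `heightDensityGE_analyticRankZero_of_pieces`.
[cite: BhargavaSkinnerZhang2014, Cor. 22 (proof)] [cite: Skinner2016PacificMC, Thm. C (p. 173)]
[cite: Duke1997, Thm. 1 (p. 815)] -/
theorem HeightDensityGE.analyticRankZero_and_fullBSDOffSs3Prime_of_pieces
    (hDD : even_selmerRank_sub_torsionRank_iff) (S₀ U W : ℤ × ℤ → Prop)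
    (hUS₀ : ∀ AB, U AB → S₀ AB) (hU : ∀ AB, U AB → U (negB AB))
    (hUflip : ∀ AB, U AB →
      (shortWeierstrass (negB AB)).rootNumber = -(shortWeierstrass AB).rootNumber)
    (h5 : ∀ AB, IsInHeightFamily AB → S₀ AB → W AB →
      Nat.card ((shortWeierstrass AB).selmerGroup 5) = 1 →
        (shortWeierstrass AB).mordellWeilRank = 0 ∧ (shortWeierstrass AB).analyticRank = 0)
    (hWtors : ∀ AB, IsInHeightFamily AB → W AB → (shortWeierstrass AB).toAffine.Point[(5 : ℤ)] = ⊥)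
    (h13U : ∀ η : ℝ, 0 < η → ∀ᶠ X : ℕ in atTop,
      ∑ AB ∈ (heightFamilyBelow X).filter U,
          (Nat.card ((shortWeierstrass AB).selmerGroup 5) : ℝ) ≤
        (6 + η) * ((heightFamilyBelow X).filter U).card)
    {κ μ₀ : ℝ} (hκ : 0 < κ) (hκ1 : κ ≤ 1) (hμ0 : 0 ≤ μ₀) (hμ1 : μ₀ ≤ 1)
    (hS₀ : ∀ η : ℝ, 0 < η → ∀ᶠ X : ℕ in atTop,
      (μ₀ - η) * (heightFamilyBelow X).card ≤ ((heightFamilyBelow X).filter S₀).card)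
    (hκU : ∀ η : ℝ, 0 < η → ∀ᶠ X : ℕ in atTop,
      (κ - η) * ((heightFamilyBelow X).filter S₀).card ≤ ((heightFamilyBelow X).filter U).card)
    (hW : ∀ η : ℝ, 0 < η → ∀ᶠ X : ℕ in atTop,
      (((heightFamilyBelow X).filter (fun AB ↦ ¬ W AB)).card : ℝ) ≤ η * (heightFamilyBelow X).card)
    (hD : Duke1997_exceptionalPrimes_densityZero) (hSk : Skinner2016_padicValRat_bsd_rank_zero)
    (hmod : hasEntireLFunction_rat) (hGZK : rank_eq_analyticRank_of_analyticRank_le_one)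
    {δ : ℝ} (hδ : δ ≤ 3 / 8 * κ * μ₀) :
    HeightDensityGE
      (fun AB ↦ AnalyticRankZero AB ∧ SatisfiesBSDRankLeOne AB ∧ FullBSDOffSs3Prime AB) δ :=
  HeightDensityGE.analyticRankZero_and_fullBSDOffSs3Prime_of_sieve hD hSk hmod hGZK
    (heightDensityGE_analyticRankZero_of_pieces hDD S₀ U W hUS₀ hU hUflip h5 hWtors h13U hκ hκ1 hμ0
      hμ1 hS₀ hκU hW hδ)

/-- **Row (ii-3a) at `p ≥ 3` and `c⁰ = 17190625/104166656 = 0.165030…`, from Bhargava–Skinner–Zhang's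
pieces at the printed `κ = .5501` (Thm. 16) and Lemma 17's exact `μ(S₀(5)) = 4·5¹⁰/(5(5¹⁰-1))`.**
The statement of `heightDensityGE_analyticRankZero_and_fullBSDOffSs3Prime_c0_of_sieve` with its
hypothesis `hA0 : HeightDensityGE AnalyticRankZero (17190625/104166656)` discharged by
`bsz_cor22_exact_of_pieces`: GIVEN Thm. 13's `5`-Selmer bound on `U` (`h13U`), Thm. 5 on `S₀ ∩ W`
(`h5`), Thm. 15 (`hDD`), the densities of `S₀`, `U ⊆ S₀`, `W` (`hS₀`, `hκU`, `hW`), Duke 1997 Thm. 1,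
Skinner 2016 Thm. C, modularity and Gross–Zagier–Kolyvagin, at least a proportion `17190625/104166656`
of the curves `E_{A,B}/ℚ`, ordered by naive height, have analytic rank `0`, satisfy the rank part of
BSD, and satisfy `BSD(E,p)` at every prime `p ≥ 3` of good ordinary or multiplicative reduction.
[cite: BhargavaSkinnerZhang2014, Cor. 22 with Lemma 17 and Thm. 16]
[cite: Skinner2016PacificMC, Thm. C (p. 173)] [cite: Duke1997, Thm. 1 (p. 815)] -/
theorem heightDensityGE_analyticRankZero_and_fullBSDOffSs3Prime_c0_of_pieces
    (hDD : even_selmerRank_sub_torsionRank_iff) (S₀ U W : ℤ × ℤ → Prop)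
    (hUS₀ : ∀ AB, U AB → S₀ AB) (hU : ∀ AB, U AB → U (negB AB))
    (hUflip : ∀ AB, U AB →
      (shortWeierstrass (negB AB)).rootNumber = -(shortWeierstrass AB).rootNumber)
    (h5 : ∀ AB, IsInHeightFamily AB → S₀ AB → W AB →
      Nat.card ((shortWeierstrass AB).selmerGroup 5) = 1 →
        (shortWeierstrass AB).mordellWeilRank = 0 ∧ (shortWeierstrass AB).analyticRank = 0)
    (hWtors : ∀ AB, IsInHeightFamily AB → W AB → (shortWeierstrass AB).toAffine.Point[(5 : ℤ)] = ⊥)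
    (h13U : ∀ η : ℝ, 0 < η → ∀ᶠ X : ℕ in atTop,
      ∑ AB ∈ (heightFamilyBelow X).filter U,
          (Nat.card ((shortWeierstrass AB).selmerGroup 5) : ℝ) ≤
        (6 + η) * ((heightFamilyBelow X).filter U).card)
    (hS₀ : ∀ η : ℝ, 0 < η → ∀ᶠ X : ℕ in atTop,
      (4 * 5 ^ 10 / (5 * (5 ^ 10 - 1)) - η) * (heightFamilyBelow X).card ≤
        ((heightFamilyBelow X).filter S₀).card)
    (hκU : ∀ η : ℝ, 0 < η → ∀ᶠ X : ℕ in atTop,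
      (0.5501 - η) * ((heightFamilyBelow X).filter S₀).card ≤ ((heightFamilyBelow X).filter U).card)
    (hW : ∀ η : ℝ, 0 < η → ∀ᶠ X : ℕ in atTop,
      (((heightFamilyBelow X).filter (fun AB ↦ ¬ W AB)).card : ℝ) ≤ η * (heightFamilyBelow X).card)
    (hD : Duke1997_exceptionalPrimes_densityZero) (hSk : Skinner2016_padicValRat_bsd_rank_zero)
    (hmod : hasEntireLFunction_rat) (hGZK : rank_eq_analyticRank_of_analyticRank_le_one) :
    HeightDensityGE
      (fun AB ↦ AnalyticRankZero AB ∧ SatisfiesBSDRankLeOne AB ∧ FullBSDOffSs3Prime AB)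
      (17190625 / 104166656) :=
  heightDensityGE_analyticRankZero_and_fullBSDOffSs3Prime_c0_of_sieve
    (BhargavaSkinnerZhang2014.HeightDensityGE.mono (fun _ h ↦ ⟨h.1, h.2.2⟩)
      (bsz_cor22_exact_of_pieces hDD S₀ U W hUS₀ hU hUflip h5 hWtors h13U hS₀ hκU hW))
    hD hSk hmod hGZK

/-- **Row (ii-3a) as certified (`p ≥ 5`, `FullBSDOffSsPrime`) at `c⁰`, from Bhargava–Skinner–Zhang's
pieces** — the `p ≥ 3` form implies it (`FullBSDOffSs3Prime.fullBSDOffSsPrime`).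
[cite: BhargavaSkinnerZhang2014, Cor. 22 with Lemma 17 and Thm. 16] -/
theorem heightDensityGE_analyticRankZero_and_fullBSDOffSsPrime_c0_of_pieces
    (hDD : even_selmerRank_sub_torsionRank_iff) (S₀ U W : ℤ × ℤ → Prop)
    (hUS₀ : ∀ AB, U AB → S₀ AB) (hU : ∀ AB, U AB → U (negB AB))
    (hUflip : ∀ AB, U AB →
      (shortWeierstrass (negB AB)).rootNumber = -(shortWeierstrass AB).rootNumber)
    (h5 : ∀ AB, IsInHeightFamily AB → S₀ AB → W AB →
      Nat.card ((shortWeierstrass AB).selmerGroup 5) = 1 →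
        (shortWeierstrass AB).mordellWeilRank = 0 ∧ (shortWeierstrass AB).analyticRank = 0)
    (hWtors : ∀ AB, IsInHeightFamily AB → W AB → (shortWeierstrass AB).toAffine.Point[(5 : ℤ)] = ⊥)
    (h13U : ∀ η : ℝ, 0 < η → ∀ᶠ X : ℕ in atTop,
      ∑ AB ∈ (heightFamilyBelow X).filter U,
          (Nat.card ((shortWeierstrass AB).selmerGroup 5) : ℝ) ≤
        (6 + η) * ((heightFamilyBelow X).filter U).card)
    (hS₀ : ∀ η : ℝ, 0 < η → ∀ᶠ X : ℕ in atTop,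
      (4 * 5 ^ 10 / (5 * (5 ^ 10 - 1)) - η) * (heightFamilyBelow X).card ≤
        ((heightFamilyBelow X).filter S₀).card)
    (hκU : ∀ η : ℝ, 0 < η → ∀ᶠ X : ℕ in atTop,
      (0.5501 - η) * ((heightFamilyBelow X).filter S₀).card ≤ ((heightFamilyBelow X).filter U).card)
    (hW : ∀ η : ℝ, 0 < η → ∀ᶠ X : ℕ in atTop,
      (((heightFamilyBelow X).filter (fun AB ↦ ¬ W AB)).card : ℝ) ≤ η * (heightFamilyBelow X).card)
    (hD : Duke1997_exceptionalPrimes_densityZero) (hSk : Skinner2016_padicValRat_bsd_rank_zero)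
    (hmod : hasEntireLFunction_rat) (hGZK : rank_eq_analyticRank_of_analyticRank_le_one) :
    HeightDensityGE
      (fun AB ↦ AnalyticRankZero AB ∧ SatisfiesBSDRankLeOne AB ∧ FullBSDOffSsPrime AB)
      (17190625 / 104166656) :=
  HeightDensityGE.analyticRankZero_and_fullBSDOffSsPrime_of_fullBSDOffSs3Prime
    (heightDensityGE_analyticRankZero_and_fullBSDOffSs3Prime_c0_of_pieces hDD S₀ U W hUS₀ hU hUflip h5
      hWtors h13U hS₀ hκU hW hD hSk hmod hGZK)

end Literature.NumberTheory.EllipticCurves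

end
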